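/-
Copyright (c) 2026 the pub-hodgecm-mathlib formalisation cell (harness21).  Prover seat hodgecm-mathlib-K2E1-p13 (g6), Track B ∕ K2-LIT, h413 = `stmt-HodgeConjecture-24833`,
R90-TF section S8 «ContSpec-n½», S8 dealer R90-CS-plan (g4), rulings J-S8-SRC (M3) ∕ J-S8-M3′ (R1): THE WITNESS IDENTIFICATION OF THE SCALAR SUB-ROW — the pair section of the (V)
road `φ₀·Θ` (`Θ = ψ∘det`) IS the unshifted pair witness `Φa^{χψ̃⁻¹, ψ}(g_∞)·Φf^{pair}(g_f)` of the unfolding of record (`p = q = 0`), because `Φa^{χ·ψ̃⁻¹, ψ} = Φa^{χ, 1}·Θ_∞` on `G_∞`.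
-/
import Summits.HodgeConjecture.HodgeConjecture.Theorems.K2E1ArchSectionLOnBigCellU3                     -- ★ (this lineage): `adelicOneChar_idelePhase` (`χ₂⟨(c•X)X⁻¹⟩ = ψ̃(X)`); brings ★ `lastRowChar_coe_units`, `archSectionE`, `OneDimAutRepH`
import Summits.HodgeConjecture.HodgeConjecture.Theorems.R90S8ChiSectionPairArchSectionShiftedU3Defs       -- ★ (this lineage): `archSectionShifted`, `archShiftFactor_zero_zero`
import Summits.HodgeConjecture.HodgeConjecture.Theorems.R90S8ChiSectionPairLevelOfRecordU3               -- ★ 3d (K2E1-p11): `isUnit_archLastRowL`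
import Summits.HodgeConjecture.HodgeConjecture.Theorems.K2E1ConstantTermTorusModulusU2                   -- ★ (K2E1): `conjAdele_conjAdele_cm`
import Literature.NumberTheory.Automorphic.UnitaryGroupDetCharacter                                       -- ★ `detChar ψ = ψ∘det` (automorphic character), `detChar_apply`
import HarnessLib

/-!
# R90-TF · S8 «ContSpec-n½» — `R90S8MidWitnessPairIdentificationU3`: `Φa^{χ·ψ̃⁻¹, ψ} = Φa^{χ,1}·(ψ∘det)_∞` — THE (V) ROAD's TWISTED WITNESS `φ₀·Θ` IS THE UNSHIFTED PAIR WITNESS OF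
# THE UNFOLDING OF RECORD (scalar sub-row `|m_w| = 1`, `p = q = 0`)

Cell `hodgecm-mathlib`, crux H413 (`stmt-HodgeConjecture-24833`, lane `--supports … --as helper`), route of record `HCCMUnconditional`; R90-TF section S8, socket (V)
`sock_S8_res_midBlock_ne_bot` (B ED. 7 :358), SCALAR SUB-ROW (J-S8-M3′: `hm1 : ∀ w, kμ_w − 2·ξ.eη_w = ±1`, so the witness exponents of record are `p = q = 0`).  THEOREMS ONLY (no `def`,
no `instance`, no `notation`, no named-fact hypothesis, no `sorry`; default heartbeats); count-neutral; CLOSES NO SOCKET.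

THE POINT (this seat's census of S8-R254 (7), mismatch (M3); J-S8-SRC «GO (M3) under `hm1`»).  The (V) chain's witness is `φ₀ ∈ V(χ; levelOfRecord K_f, ω^{χ,1})` (`χ = ξ.bcη⁻¹·μω`),
consumed through the twisted pair section `φ₀·Θ ∈ V(χ·ψ̃⁻¹, ψ; K′, ω·Θ)` (`Θ := detChar ξ.ψ = ψ∘det`, `ψ̃ = pullback ξ.ψ = ξ.bcψ` by `rfl`; ★ FILE A `mul_detChar_mem_chiSectionSpacePair`), while
the unfolding of record (★ p864821 `hsrc_of_record_at_basePoint_of_core`) reads the PAIR witness `g ↦ archSectionShifted (χ·ψ̃⁻¹) ψ p q (g_∞)·Φf(g_f)`.  On the scalar sub-row `p = q = 0`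
(★ `archShiftFactor_zero_zero`: `Φ^{0,0} = Φa`), and the two witnesses MATCH because of the archimedean identity
**`Φa^{χ·ψ̃⁻¹, ψ}(a) = Φa^{χ,1}(a)·Θ(ι a)`** for every `a ∈ G_∞` (§2): by ★ D8′ `Φa^{χ₁,χ₂}(a) = Θ^{χ₁,χ₂}(ℓ(a))·ρ_E(a)·χ₂⟨det ι a⟩` with `Θ^{χ₁,χ₂}(X) = χ₁(c•X)⁻¹·χ₂⟨(c•X)X⁻¹⟩` (★ `lastRowChar_coe_units`) and
`χ₂⟨(c•X)X⁻¹⟩ = ψ̃(X)` (★ `adelicOneChar_idelePhase`), the left side is `χ(c•ℓ)⁻¹·ψ̃(c•ℓ)·ψ̃(ℓ)·ρ_E·ψ⟨det ι a⟩` and the right side is `χ(c•ℓ)⁻¹·ρ_E·ψ⟨det ι a⟩`; they agree since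
**`ψ̃(c•X)·ψ̃(X) = ψ̃((c•X)·X) = 1`** — `(c•X)·X` is `c`-fixed, so its Hilbert-90 twist `c•y∕y` is `1` (§1; [Rogawski1990, §12.2 p. 174]).  Hence (§3), for any finite reading `Φf`,
`(Φa^{χ,1}(g_∞)·Φf(g_f))·Θ(g) = archSectionShifted (χ·ψ̃⁻¹) ψ 0 0 (g_∞)·(Φf(g_f)·Θ(ι_f g_f))` (`Θ(g) = Θ(ι g_∞)·Θ(ι_f g_f)`, ★ `archToAdelic_mul_finAdelicToAdelic`): the keeper's `φ₀·Θ` IS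
★ p864821's witness with `Φf^{pair} := Φf·(Θ ∘ ι_f)`, `p = q = 0`.
* §1 **`bcψ_conjAdele_mul_self`** — `ψ̃(c•X)·ψ̃(X) = 1` for every idele `X`.
* §2 **`archSectionE_mul_bcψ_inv_eq_mul_detChar`** — `Φa^{χ·ψ̃⁻¹, ψ}(a) = Φa^{χ,1}(a)·Θ(ι a)`; **`archSectionE_blockPair_eq_mul_detChar`** — the same at the block pair of record
  `(ξ.bcη⁻¹·ξ.bcψ⁻¹·μω, ξ.ψ)` vs `(ξ.bcη⁻¹·μω, 1)`.
* §3 **`untwisted_mul_detChar_eq_pairWitness`** — the witness identification, pointwise on `G(𝔸)`.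
HONEST LABEL: HC_CM is proved only modulo the 7 printed citations (2 remaining named inputs: hLiu418 = `stmt-HodgeConjecture-24832`, h413 = `stmt-HodgeConjecture-24833`) until rung 0
closes; REL ≠ ★ ≠ BUILT; letter-free identities; they serve ONLY the scalar sub-row `p = q = 0` of the (V) column (J-S8-M3′ (b)); the general sub-row (some `|m_w| ≥ 3`) is the (V-τ) road
(LH4-p10), where the shifted witness lives in a higher `K_∞`-type and NO such scalar identification exists; this file asserts no named fact and closes no socket; count-neutral.

## References
* [Rogawski1990] J. D. Rogawski, *Automorphic Representations of Unitary Groups in Three Variables* (1990), §1.10, §12.2 p. 174, §13.3 p. 202, §13.9 p. 229.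
* [MoeglinWaldspurger1995] C. Mœglin, J.-L. Waldspurger, *Spectral Decomposition and Eisenstein Series* (1995), I.2.17, II.1.7.
* [BorelJacquet1979] A. Borel, H. Jacquet, *Automorphic forms and automorphic representations*, PSPM 33.1 (1979), §4.1.
-/

set_option autoImplicit false
set_option linter.dupNamespace false  -- the mandated namespace `…HodgeConjecture.HodgeConjecture.R90.S8` (LEAD #1 L1) repeats the summit's segment

noncomputable section

open NumberField IsDedekindDomain
open scoped ComplexConjugate
open Literature.NumberTheory Literature.NumberTheory.Automorphic Literature.NumberTheory.Automorphic.UnitaryGroup Literature.NumberTheory.GaloisRepresentations AdelicGroupData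
open Literature.NumberTheory.Automorphic.Arthur2013.Leaves.TECR Literature.NumberTheory.Rogawski1990
open Literature.NumberTheory.Automorphic.UnitaryGroup.AdelicCharactersDetQuasiSplit (antidiagonal_over_det_ne_zero)
open Summit.HodgeConjecture.HodgeConjecture.Cruxes.H413.K2E1ArchSectionLOnBigCellU3 (adelicOneChar_idelePhase)
open Summit.HodgeConjecture.HodgeConjecture.Cruxes.H413.K2E1ConstantTermTorusModulusU2 (conjAdele_conjAdele_cm)

namespace Summit.HodgeConjecture.HodgeConjecture.R90.S8

variable (L : Type) [Field L] [NumberField L] [IsCMField L]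

/-! ## §1 `ψ̃(c•X)·ψ̃(X) = 1` -/

/-- **`ψ̃(c•X)·ψ̃(X) = 1`** for every idele `X` of `L`: `ψ̃ = ψ ∘ (y ↦ c•y∕y)` (★ `OneDimAutRepH.bcψ_apply`, ★ `TorusDict.twistToTorus`) and `(c•X)·X` is `c`-fixed (`c` an involution, ★
`conjAdele_conjAdele_cm`), so its twist is `1` (★ `Herbrand.twist_eq_one_iff`). [cite: Rogawski1990, §12.2 p. 174] -/
theorem bcψ_conjAdele_mul_self (ξ : OneDimAutRepH L) (X : ideleGroup L) :
    ξ.bcψ (Units.map (conjAdele (↥(maximalRealSubfield L)) L (IsCMField.complexConj L) : AdeleRing (𝓞 L) L →* AdeleRing (𝓞 L) L) X) * ξ.bcψ X = 1 := by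
  have hcX : Units.map (conjAdele (↥(maximalRealSubfield L)) L (IsCMField.complexConj L) : AdeleRing (𝓞 L) L →* AdeleRing (𝓞 L) L) X = IsCMField.complexConj L • X :=
    Units.ext rfl
  have hfix : IsCMField.complexConj L • (IsCMField.complexConj L • X * X) = IsCMField.complexConj L • X * X := by
    rw [smul_mul', mul_comm]
    congr 1
    refine Units.ext ?_
    rw [AdeleRing.coe_smul_units, AdeleRing.coe_smul_units, ← conjAdele_apply, ← conjAdele_apply]
    exact conjAdele_conjAdele_cm L (X : AdeleRing (𝓞 L) L)
  have htw : ∀ (h2 : Module.finrank ↥(maximalRealSubfield L) L = 2) (hc : IsCMField.complexConj L ≠ 1),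
      TorusDict.twistToTorus (IsCMField.complexConj L) h2 hc (IsCMField.complexConj L • X * X) = 1 := fun h2 hc =>
    Subtype.ext (by rw [TorusDict.coe_twistToTorus_apply, OneMemClass.coe_one]; exact Herbrand.twist_eq_one_iff.2 hfix)
  rw [hcX, ← map_mul, OneDimAutRepH.bcψ_apply, htw, map_one]

/-! ## §2 `Φa^{χ·ψ̃⁻¹, ψ} = Φa^{χ,1}·Θ_∞` -/

/-- **`Φa^{χ·ψ̃⁻¹, ψ}(a) = Φa^{χ,1}(a)·Θ(ι a)`** on `G_∞`, `Θ = detChar ξ.ψ = ψ∘det`: ★ D8′ + ★ `lastRowChar_coe_units` + ★ `adelicOneChar_idelePhase` + §1.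
[cite: Rogawski1990, §1.10, §12.2 p. 174, §13.3 p. 202] [cite: BorelJacquet1979, §4.1] -/
theorem archSectionE_mul_bcψ_inv_eq_mul_detChar (χ : HeckeCharacter L) (ξ : OneDimAutRepH L)
    (h2 : Module.finrank ↥(maximalRealSubfield L) L = 2) (hc : IsCMField.complexConj L ≠ 1)
    (a : arch (↥(maximalRealSubfield L)) L (IsCMField.complexConj L) 3 ((StdForm.antidiagonal 3).over L)) :
    archSectionE L (χ * ξ.bcψ⁻¹) ξ.ψ a =
      archSectionE L χ (1 : ↥(TorusDict.torus (IsCMField.complexConj L)) →ₜ* ℂˣ) a *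
        ((detChar (↥(maximalRealSubfield L)) L (IsCMField.complexConj L) h2 hc 3 ((StdForm.antidiagonal 3).over L) ξ.ψ ξ.hψ (antidiagonal_over_det_ne_zero L 3)
          (archToAdelic (↥(maximalRealSubfield L)) L (IsCMField.complexConj L) 3 ((StdForm.antidiagonal 3).over L) a) : ℂˣ) : ℂ) := by
  rw [archSectionE_def, archSectionE_def]
  have hXv : ((isUnit_archLastRowL L a).unit : AdeleRing (𝓞 L) L) = archLastRowL L a := (isUnit_archLastRowL L a).unit_spec
  rw [← hXv, lastRowChar_coe_units, lastRowChar_coe_units, adelicOneChar_idelePhase]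
  set X : (AdeleRing (𝓞 L) L)ˣ := (isUnit_archLastRowL L a).unit with hX
  -- the `χ₂ = 1` factors are `1`
  have h1t : ∀ t : ↥(adelicOne (↥(maximalRealSubfield L)) L (IsCMField.complexConj L)),
      ((adelicOneChar (↥(maximalRealSubfield L)) L (IsCMField.complexConj L) (1 : ↥(TorusDict.torus (IsCMField.complexConj L)) →ₜ* ℂˣ) t : ℂˣ) : ℂ) = 1 := fun t => by
    rw [adelicOneChar_apply, ContinuousMonoidHom.coe_one, Pi.one_apply, Units.val_one]
  -- the `ψ`-factor of the determinant is `Θ(ι a)`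
  have hdet : ((adelicOneChar (↥(maximalRealSubfield L)) L (IsCMField.complexConj L) ξ.ψ
      (adelicDet (↥(maximalRealSubfield L)) L (IsCMField.complexConj L) 3 ((StdForm.antidiagonal 3).over L) (antidiagonal_over_det_ne_zero L 3)
        (archToAdelic (↥(maximalRealSubfield L)) L (IsCMField.complexConj L) 3 ((StdForm.antidiagonal 3).over L) a)) : ℂˣ) : ℂ) =
      ((detChar (↥(maximalRealSubfield L)) L (IsCMField.complexConj L) h2 hc 3 ((StdForm.antidiagonal 3).over L) ξ.ψ ξ.hψ (antidiagonal_over_det_ne_zero L 3)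
          (archToAdelic (↥(maximalRealSubfield L)) L (IsCMField.complexConj L) 3 ((StdForm.antidiagonal 3).over L) a) : ℂˣ) : ℂ) := by
    rw [adelicOneChar_apply, detChar_apply]
  -- `ψ̃(X) = ψ̃(c•X)⁻¹` (§1)
  have hk : ξ.bcψ X = (ξ.bcψ (Units.map (conjAdele (↥(maximalRealSubfield L)) L (IsCMField.complexConj L) : AdeleRing (𝓞 L) L →* AdeleRing (𝓞 L) L) X))⁻¹ :=
    eq_inv_of_mul_eq_one_right (bcψ_conjAdele_mul_self L ξ X)
  rw [hdet, hk, HeckeCharacter.mul_apply, HeckeCharacter.inv_apply]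
  have hne : ((ξ.bcψ (Units.map (conjAdele (↥(maximalRealSubfield L)) L (IsCMField.complexConj L) : AdeleRing (𝓞 L) L →* AdeleRing (𝓞 L) L) X) : ℂˣ) : ℂ) ≠ 0 :=
    Units.ne_zero _
  simp only [h1t, map_inv, Units.val_mul, Units.val_inv_eq_inv_val, inv_inv, mul_one]
  field_simp

/-- **The same at the BLOCK PAIR OF RECORD**: `Φa^{ξ.bcη⁻¹·ξ.bcψ⁻¹·μω, ξ.ψ}(a) = Φa^{ξ.bcη⁻¹·μω, 1}(a)·Θ(ι a)` (`χ·ψ̃⁻¹ = ξ.bcη⁻¹·ξ.bcψ⁻¹·μω` at `χ = ξ.bcη⁻¹·μω`, `mul_right_comm`).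
[cite: Rogawski1990, §12.2 p. 174, §13.9 p. 229] -/
theorem archSectionE_blockPair_eq_mul_detChar (ξ : OneDimAutRepH L) (μω : HeckeCharacter L)
    (h2 : Module.finrank ↥(maximalRealSubfield L) L = 2) (hc : IsCMField.complexConj L ≠ 1)
    (a : arch (↥(maximalRealSubfield L)) L (IsCMField.complexConj L) 3 ((StdForm.antidiagonal 3).over L)) :
    archSectionE L (ξ.bcη⁻¹ * ξ.bcψ⁻¹ * μω) ξ.ψ a =
      archSectionE L (ξ.bcη⁻¹ * μω) (1 : ↥(TorusDict.torus (IsCMField.complexConj L)) →ₜ* ℂˣ) a *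
        ((detChar (↥(maximalRealSubfield L)) L (IsCMField.complexConj L) h2 hc 3 ((StdForm.antidiagonal 3).over L) ξ.ψ ξ.hψ (antidiagonal_over_det_ne_zero L 3)
          (archToAdelic (↥(maximalRealSubfield L)) L (IsCMField.complexConj L) 3 ((StdForm.antidiagonal 3).over L) a) : ℂˣ) : ℂ) := by
  rw [show ξ.bcη⁻¹ * ξ.bcψ⁻¹ * μω = ξ.bcη⁻¹ * μω * ξ.bcψ⁻¹ from mul_right_comm _ _ _]
  exact archSectionE_mul_bcψ_inv_eq_mul_detChar L (ξ.bcη⁻¹ * μω) ξ h2 hc a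

/-! ## §3 The witness identification on `G(𝔸)` -/

/-- **`(Φa^{χ,1}(g_∞)·Φf(g_f))·Θ(g) = archSectionShifted (χ·ψ̃⁻¹) ψ 0 0 (g_∞)·(Φf(g_f)·Θ(ι_f g_f))`** for every finite reading `Φf` and every `g ∈ G(𝔸)`: the (V) road's twisted witness `φ₀·Θ`
(with `φ₀ = Φa^{χ,1}(g_∞)·Φf(g_f)`, ★ structure theorem at the level of record) IS the UNSHIFTED (`p = q = 0`, ★ `archShiftFactor_zero_zero`) pair witness of ★ p864821 with finite reading
`Φf^{pair} := Φf·(Θ ∘ ι_f)` (§2 and `Θ(g) = Θ(ι g_∞)·Θ(ι_f g_f)`, ★ `archToAdelic_mul_finAdelicToAdelic`). [cite: Rogawski1990, §1.10, §13.3 p. 202] [cite: MoeglinWaldspurger1995, II.1.7] -/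
theorem untwisted_mul_detChar_eq_pairWitness (χ : HeckeCharacter L) (ξ : OneDimAutRepH L)
    (h2 : Module.finrank ↥(maximalRealSubfield L) L = 2) (hc : IsCMField.complexConj L ≠ 1)
    (Φf : ↥(finAdelic (↥(maximalRealSubfield L)) L (IsCMField.complexConj L) 3 ((StdForm.antidiagonal 3).over L)) → ℂ)
    (g : (quasiSplit (↥(maximalRealSubfield L)) L (IsCMField.complexConj L) 3).Adelic) :
    archSectionE L χ (1 : ↥(TorusDict.torus (IsCMField.complexConj L)) →ₜ* ℂˣ) (archPart (↥(maximalRealSubfield L)) L (IsCMField.complexConj L) 3 ((StdForm.antidiagonal 3).over L) g) *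
        Φf (finPart (↥(maximalRealSubfield L)) L (IsCMField.complexConj L) 3 ((StdForm.antidiagonal 3).over L) g) *
        ((detChar (↥(maximalRealSubfield L)) L (IsCMField.complexConj L) h2 hc 3 ((StdForm.antidiagonal 3).over L) ξ.ψ ξ.hψ (antidiagonal_over_det_ne_zero L 3) g : ℂˣ) : ℂ) =
      archSectionShifted L (χ * ξ.bcψ⁻¹) ξ.ψ 0 0 (archPart (↥(maximalRealSubfield L)) L (IsCMField.complexConj L) 3 ((StdForm.antidiagonal 3).over L) g) *
        (Φf (finPart (↥(maximalRealSubfield L)) L (IsCMField.complexConj L) 3 ((StdForm.antidiagonal 3).over L) g) *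
          ((detChar (↥(maximalRealSubfield L)) L (IsCMField.complexConj L) h2 hc 3 ((StdForm.antidiagonal 3).over L) ξ.ψ ξ.hψ (antidiagonal_over_det_ne_zero L 3)
            (finAdelicToAdelic (↥(maximalRealSubfield L)) L (IsCMField.complexConj L) 3 ((StdForm.antidiagonal 3).over L)
              (finPart (↥(maximalRealSubfield L)) L (IsCMField.complexConj L) 3 ((StdForm.antidiagonal 3).over L) g)) : ℂˣ) : ℂ)) := by
  have hΘ : detChar (↥(maximalRealSubfield L)) L (IsCMField.complexConj L) h2 hc 3 ((StdForm.antidiagonal 3).over L) ξ.ψ ξ.hψ (antidiagonal_over_det_ne_zero L 3) g =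
      detChar (↥(maximalRealSubfield L)) L (IsCMField.complexConj L) h2 hc 3 ((StdForm.antidiagonal 3).over L) ξ.ψ ξ.hψ (antidiagonal_over_det_ne_zero L 3)
          (archToAdelic (↥(maximalRealSubfield L)) L (IsCMField.complexConj L) 3 ((StdForm.antidiagonal 3).over L)
            (archPart (↥(maximalRealSubfield L)) L (IsCMField.complexConj L) 3 ((StdForm.antidiagonal 3).over L) g)) *
        detChar (↥(maximalRealSubfield L)) L (IsCMField.complexConj L) h2 hc 3 ((StdForm.antidiagonal 3).over L) ξ.ψ ξ.hψ (antidiagonal_over_det_ne_zero L 3)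
          (finAdelicToAdelic (↥(maximalRealSubfield L)) L (IsCMField.complexConj L) 3 ((StdForm.antidiagonal 3).over L)
            (finPart (↥(maximalRealSubfield L)) L (IsCMField.complexConj L) 3 ((StdForm.antidiagonal 3).over L) g)) := by
    conv_lhs => rw [← archToAdelic_mul_finAdelicToAdelic (↥(maximalRealSubfield L)) L (IsCMField.complexConj L) 3 ((StdForm.antidiagonal 3).over L) g]
    rw [map_mul]
  rw [archSectionShifted_def, archShiftFactor_zero_zero, one_mul, archSectionE_mul_bcψ_inv_eq_mul_detChar L χ ξ h2 hc, hΘ, Units.val_mul]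
  ring

end Summit.HodgeConjecture.HodgeConjecture.R90.S8

end
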